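import Mathlib
import HarnessLib
import Literature.MathematicalPhysics.QuantumLattice.GrassmannLinearSubstitution

/-!
# Route `KLProgramme` — crux K3, the nested two-volume pass on the DOUBLED (source-carrying) labels `Γ × Fin 2`: the BLOCK SUBSTITUTIONS `T⁺ = T ⊕ J`
# (companion of `…TwoVolumeDoubledData`; cell gate-hubbard-kl, seat hubbard-kl-k3c4-p1 g11; `--supports` stmt-HubbardSuperconductivity-20440)

The re-sectorisation / read-out substitutions of the augmented two-volume induction act copy by copy: `T⁺ p′ p = T p′.1 p.1` on the alive copy, `J p′.1 p.1`
on the source copy, `0` across copies (`…TwoVolumeDoubledTowerStep`, property form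
`hT⁺ : ∀ p′ p, T⁺ p′ p = if p′.2 = 0 ∧ p.2 = 0 then T p′.1 p.1 else if p′.2 = 1 ∧ p.2 = 1 then J p′.1 p.1 else 0`).  The substitution hypotheses of
`…TwoVolumeScaleSucc.twoVolume_scale_succ_le` (periodisation `(P_T)`, column masses, pin rows, box-collapsed columns, tails — all filtered row / column
sums of `‖T⁺‖`) for `T⁺` follow from those of the two blocks:

* `doubleBlock_periodise` — `(P_T)` for `T⁺` over the doubled block structures from `(P_T)` for `T` and for `J`;
* `sum_filter_norm_doubleBlock_row/_col` — master formulas: a filtered row (column) sum of `‖T⁺‖` at a label of copy `s` is the filtered row (column) sum of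
  the block of copy `s`; `…_row_le/_col_le`, `sum_norm_doubleBlock_row_le/_col_le` — the bounds from the two blocks;
* `norm_doubleBlock_le_of_blocks`, `doubleBlock_sub` — entrywise majorants and differences blockwise (inputs of
  `…TwoVolumeSubstitutionLipschitz.sum_pinned_norm_kernel_map_sub_map_le` for the frame-mismatch bracket).

Everything is proved; no definition; model-free.  References: BGM 2006 §2.9 (4.3)–(4.8); Salmhofer 1999 §4.3.
-/

noncomputable section

namespace Summit.HubbardSuperconductivity.HubbardSuperconductivity.Theorems.TwoVolumeDefect

set_option linter.dupNamespace false -- summit = problem name (single-conjunct summit), D-0017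

open Finset

/-! ## Block substitutions `T⁺ = T ⊕ J`: periodisation and filtered sums -/

section DoubleBlock

variable {𝕜 : Type*} [RCLike 𝕜] {ι Γ₁ Γ₂ Γ₁' Γ₂' : Type*}

/-- **(P_T) lifts**: if the fine substitution periodises onto the coarse one block by block, for the alive block `T` AND for the source block `J`, then so does
`T⁺ = T ⊕ J` over the doubled block structures. [folklore] -/
theorem doubleBlock_periodise [Fintype Γ₁'] [DecidableEq Γ₁] (e₁ : Γ₁' ≃ ι × Γ₁) (e₂ : Γ₂' ≃ ι × Γ₂)
    (ed₁ : (Γ₁' × Fin 2) ≃ ι × (Γ₁ × Fin 2)) (hed₁ : ∀ x s, ed₁ (x, s) = ((e₁ x).1, ((e₁ x).2, s)))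
    (ed₂ : (Γ₂' × Fin 2) ≃ ι × (Γ₂ × Fin 2)) (hed₂ : ∀ x s, ed₂ (x, s) = ((e₂ x).1, ((e₂ x).2, s)))
    (Tc Jc : Matrix Γ₂ Γ₁ 𝕜) (Tf Jf : Matrix Γ₂' Γ₁' 𝕜) (Tpc : Matrix (Γ₂ × Fin 2) (Γ₁ × Fin 2) 𝕜) (Tpf : Matrix (Γ₂' × Fin 2) (Γ₁' × Fin 2) 𝕜)
    (hTpc : ∀ p' p, Tpc p' p = if p'.2 = 0 ∧ p.2 = 0 then Tc p'.1 p.1 else if p'.2 = 1 ∧ p.2 = 1 then Jc p'.1 p.1 else 0)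
    (hTpf : ∀ p' p, Tpf p' p = if p'.2 = 0 ∧ p.2 = 0 then Tf p'.1 p.1 else if p'.2 = 1 ∧ p.2 = 1 then Jf p'.1 p.1 else 0)
    (hPT : ∀ (X' : Γ₂') (Y : Γ₁), ∑ Y'' ∈ univ.filter (fun Y'' : Γ₁' => (e₁ Y'').2 = Y), Tf X' Y'' = Tc (e₂ X').2 Y)
    (hPJ : ∀ (X' : Γ₂') (Y : Γ₁), ∑ Y'' ∈ univ.filter (fun Y'' : Γ₁' => (e₁ Y'').2 = Y), Jf X' Y'' = Jc (e₂ X').2 Y)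
    (X' : Γ₂' × Fin 2) (Y : Γ₁ × Fin 2) :
    ∑ Y'' ∈ univ.filter (fun Y'' : Γ₁' × Fin 2 => (ed₁ Y'').2 = Y), Tpf X' Y'' = Tpc (ed₂ X').2 Y := by
  obtain ⟨x', s⟩ := X'
  obtain ⟨y, t⟩ := Y
  have hfilter : univ.filter (fun Y'' : Γ₁' × Fin 2 => (ed₁ Y'').2 = (y, t)) =
      (univ.filter (fun Y'' : Γ₁' => (e₁ Y'').2 = y)) ×ˢ ({t} : Finset (Fin 2)) := by
    ext ⟨y'', t'⟩
    simp only [mem_filter, mem_univ, true_and, mem_product, mem_singleton, hed₁, Prod.mk.injEq]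
  rw [hfilter, sum_product, hed₂]
  simp only [sum_singleton, hTpf, hTpc]
  by_cases hs0 : s = 0
  · subst hs0
    by_cases ht0 : t = 0
    · subst ht0
      simp only [and_self, if_true]
      exact hPT x' y
    · have ht1 : t = 1 := by
        rcases Fin.exists_fin_two.1 ⟨t, rfl⟩ with h | h
        · exact absurd h ht0
        · exact h
      subst ht1
      simp
  · have hs1 : s = 1 := by
      rcases Fin.exists_fin_two.1 ⟨s, rfl⟩ with h | h
      · exact absurd h hs0
      · exact h
    subst hs1
    by_cases ht1 : t = 1
    · subst ht1
      simp only [Fin.isValue, one_ne_zero, if_false, and_self, if_true]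
      exact hPJ x' y
    · have ht0 : t = 0 := by
        rcases Fin.exists_fin_two.1 ⟨t, rfl⟩ with h | h
        · exact h
        · exact absurd h ht1
      subst ht0
      simp

/-- **Master formula, rows of `T⁺`**: a filtered row sum at an out-label of copy `s` is the filtered row sum of the block of that copy over the in-labels of the
same copy. [folklore] -/
theorem sum_filter_norm_doubleBlock_row [Fintype Γ₁] (T J : Matrix Γ₂ Γ₁ 𝕜) (Tp : Matrix (Γ₂ × Fin 2) (Γ₁ × Fin 2) 𝕜)
    (hTp : ∀ p' p, Tp p' p = if p'.2 = 0 ∧ p.2 = 0 then T p'.1 p.1 else if p'.2 = 1 ∧ p.2 = 1 then J p'.1 p.1 else 0)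
    (Q : Γ₁ × Fin 2 → Prop) [DecidablePred Q] (p' : Γ₂ × Fin 2) :
    ∑ p ∈ univ.filter Q, ‖Tp p' p‖ =
      if p'.2 = 0 then ∑ y ∈ univ.filter (fun y : Γ₁ => Q (y, 0)), ‖T p'.1 y‖ else ∑ y ∈ univ.filter (fun y : Γ₁ => Q (y, 1)), ‖J p'.1 y‖ := by
  classical
  have h10 : ¬ ((1 : Fin 2) = 0) := by decide
  have h01 : ¬ ((0 : Fin 2) = 1) := by decide
  have e00 : ∀ x y, Tp (x, 0) (y, 0) = T x y := fun x y => by rw [hTp, if_pos ⟨rfl, rfl⟩]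
  have e11 : ∀ x y, Tp (x, 1) (y, 1) = J x y := fun x y => by rw [hTp, if_neg (fun h => h10 h.1), if_pos ⟨rfl, rfl⟩]
  have e01 : ∀ x y, Tp (x, 0) (y, 1) = 0 := fun x y => by rw [hTp, if_neg (fun h => h10 h.2), if_neg (fun h => h01 h.1)]
  have e10 : ∀ x y, Tp (x, 1) (y, 0) = 0 := fun x y => by rw [hTp, if_neg (fun h => h10 h.1), if_neg (fun h => h01 h.2)]
  obtain ⟨x', s⟩ := p'
  rw [sum_filter, Fintype.sum_prod_type, sum_filter, sum_filter]
  by_cases hs : s = 0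
  · subst hs
    rw [if_pos rfl]
    refine sum_congr rfl fun y _ => ?_
    rw [Fin.sum_univ_two, e00, e01, norm_zero, ite_self, add_zero]
  · have hs1 : s = 1 := by
      rcases Fin.exists_fin_two.1 ⟨s, rfl⟩ with h | h
      · exact absurd h hs
      · exact h
    subst hs1
    rw [if_neg h10]
    refine sum_congr rfl fun y _ => ?_
    rw [Fin.sum_univ_two, e10, e11, norm_zero, ite_self, zero_add]

/-- **Master formula, columns of `T⁺`**. [folklore] -/
theorem sum_filter_norm_doubleBlock_col [Fintype Γ₂] (T J : Matrix Γ₂ Γ₁ 𝕜) (Tp : Matrix (Γ₂ × Fin 2) (Γ₁ × Fin 2) 𝕜)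
    (hTp : ∀ p' p, Tp p' p = if p'.2 = 0 ∧ p.2 = 0 then T p'.1 p.1 else if p'.2 = 1 ∧ p.2 = 1 then J p'.1 p.1 else 0)
    (Q : Γ₂ × Fin 2 → Prop) [DecidablePred Q] (p : Γ₁ × Fin 2) :
    ∑ p' ∈ univ.filter Q, ‖Tp p' p‖ =
      if p.2 = 0 then ∑ x ∈ univ.filter (fun x : Γ₂ => Q (x, 0)), ‖T x p.1‖ else ∑ x ∈ univ.filter (fun x : Γ₂ => Q (x, 1)), ‖J x p.1‖ := by
  classical
  have h10 : ¬ ((1 : Fin 2) = 0) := by decide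
  have h01 : ¬ ((0 : Fin 2) = 1) := by decide
  have e00 : ∀ x y, Tp (x, 0) (y, 0) = T x y := fun x y => by rw [hTp, if_pos ⟨rfl, rfl⟩]
  have e11 : ∀ x y, Tp (x, 1) (y, 1) = J x y := fun x y => by rw [hTp, if_neg (fun h => h10 h.1), if_pos ⟨rfl, rfl⟩]
  have e01 : ∀ x y, Tp (x, 0) (y, 1) = 0 := fun x y => by rw [hTp, if_neg (fun h => h10 h.2), if_neg (fun h => h01 h.1)]
  have e10 : ∀ x y, Tp (x, 1) (y, 0) = 0 := fun x y => by rw [hTp, if_neg (fun h => h10 h.1), if_neg (fun h => h01 h.2)]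
  obtain ⟨y, s⟩ := p
  rw [sum_filter, Fintype.sum_prod_type, sum_filter, sum_filter]
  by_cases hs : s = 0
  · subst hs
    rw [if_pos rfl]
    refine sum_congr rfl fun x _ => ?_
    rw [Fin.sum_univ_two, e00, e10, norm_zero, ite_self, add_zero]
  · have hs1 : s = 1 := by
      rcases Fin.exists_fin_two.1 ⟨s, rfl⟩ with h | h
      · exact absurd h hs
      · exact h
    subst hs1
    rw [if_neg h10]
    refine sum_congr rfl fun x _ => ?_
    rw [Fin.sum_univ_two, e01, e11, norm_zero, ite_self, zero_add]

/-- **Filtered row sums of `T⁺` from the two blocks**: if the `T`-row sum over `{y | Q (y,0)}` and the `J`-row sum over `{y | Q (y,1)}` are both `≤ a`, so is the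
`T⁺`-row sum over `{p | Q p}`. [folklore] -/
theorem sum_filter_norm_doubleBlock_row_le [Fintype Γ₁] (T J : Matrix Γ₂ Γ₁ 𝕜) (Tp : Matrix (Γ₂ × Fin 2) (Γ₁ × Fin 2) 𝕜)
    (hTp : ∀ p' p, Tp p' p = if p'.2 = 0 ∧ p.2 = 0 then T p'.1 p.1 else if p'.2 = 1 ∧ p.2 = 1 then J p'.1 p.1 else 0)
    (Q : Γ₁ × Fin 2 → Prop) [DecidablePred Q] (p' : Γ₂ × Fin 2) {a : ℝ}
    (hT : ∑ y ∈ univ.filter (fun y : Γ₁ => Q (y, 0)), ‖T p'.1 y‖ ≤ a) (hJ : ∑ y ∈ univ.filter (fun y : Γ₁ => Q (y, 1)), ‖J p'.1 y‖ ≤ a) :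
    ∑ p ∈ univ.filter Q, ‖Tp p' p‖ ≤ a := by
  rw [sum_filter_norm_doubleBlock_row T J Tp hTp Q p']
  split_ifs
  · exact hT
  · exact hJ

/-- **Filtered column sums of `T⁺` from the two blocks**. [folklore] -/
theorem sum_filter_norm_doubleBlock_col_le [Fintype Γ₂] (T J : Matrix Γ₂ Γ₁ 𝕜) (Tp : Matrix (Γ₂ × Fin 2) (Γ₁ × Fin 2) 𝕜)
    (hTp : ∀ p' p, Tp p' p = if p'.2 = 0 ∧ p.2 = 0 then T p'.1 p.1 else if p'.2 = 1 ∧ p.2 = 1 then J p'.1 p.1 else 0)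
    (Q : Γ₂ × Fin 2 → Prop) [DecidablePred Q] (p : Γ₁ × Fin 2) {a : ℝ}
    (hT : ∑ x ∈ univ.filter (fun x : Γ₂ => Q (x, 0)), ‖T x p.1‖ ≤ a) (hJ : ∑ x ∈ univ.filter (fun x : Γ₂ => Q (x, 1)), ‖J x p.1‖ ≤ a) :
    ∑ p' ∈ univ.filter Q, ‖Tp p' p‖ ≤ a := by
  rw [sum_filter_norm_doubleBlock_col T J Tp hTp Q p]
  split_ifs
  · exact hT
  · exact hJ

/-- **Full column sums of `T⁺`** (the mass hypothesis `hcolT`): `Σ_{p′} ‖T⁺ p′ p‖ ≤ a` from the column sums of `T` and `J`. [folklore] -/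
theorem sum_norm_doubleBlock_col_le [Fintype Γ₂] (T J : Matrix Γ₂ Γ₁ 𝕜) (Tp : Matrix (Γ₂ × Fin 2) (Γ₁ × Fin 2) 𝕜)
    (hTp : ∀ p' p, Tp p' p = if p'.2 = 0 ∧ p.2 = 0 then T p'.1 p.1 else if p'.2 = 1 ∧ p.2 = 1 then J p'.1 p.1 else 0)
    {a : ℝ} (hT : ∀ y, ∑ x, ‖T x y‖ ≤ a) (hJ : ∀ y, ∑ x, ‖J x y‖ ≤ a) (p : Γ₁ × Fin 2) : ∑ p', ‖Tp p' p‖ ≤ a := by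
  classical
  have h := sum_filter_norm_doubleBlock_col_le T J Tp hTp (fun _ => True) p (a := a)
    (by rw [filter_true_of_mem fun _ _ => trivial]; exact hT p.1) (by rw [filter_true_of_mem fun _ _ => trivial]; exact hJ p.1)
  rwa [filter_true_of_mem fun _ _ => trivial] at h

/-- **Full row sums of `T⁺`**: `Σ_p ‖T⁺ p′ p‖ ≤ a` from the row sums of `T` and `J`. [folklore] -/
theorem sum_norm_doubleBlock_row_le [Fintype Γ₁] (T J : Matrix Γ₂ Γ₁ 𝕜) (Tp : Matrix (Γ₂ × Fin 2) (Γ₁ × Fin 2) 𝕜)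
    (hTp : ∀ p' p, Tp p' p = if p'.2 = 0 ∧ p.2 = 0 then T p'.1 p.1 else if p'.2 = 1 ∧ p.2 = 1 then J p'.1 p.1 else 0)
    {a : ℝ} (hT : ∀ x, ∑ y, ‖T x y‖ ≤ a) (hJ : ∀ x, ∑ y, ‖J x y‖ ≤ a) (p' : Γ₂ × Fin 2) : ∑ p, ‖Tp p' p‖ ≤ a := by
  classical
  have h := sum_filter_norm_doubleBlock_row_le T J Tp hTp (fun _ => True) p' (a := a)
    (by rw [filter_true_of_mem fun _ _ => trivial]; exact hT p'.1) (by rw [filter_true_of_mem fun _ _ => trivial]; exact hJ p'.1)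
  rwa [filter_true_of_mem fun _ _ => trivial] at h

/-- **A common entrywise majorant of two block substitutions** is the block of the blockwise majorants (input of
`…TwoVolumeSubstitutionLipschitz.sum_pinned_norm_kernel_map_sub_map_le` for the frame-mismatch bracket). [folklore] -/
theorem norm_doubleBlock_le_of_blocks (T J : Matrix Γ₂ Γ₁ 𝕜) (Tp : Matrix (Γ₂ × Fin 2) (Γ₁ × Fin 2) 𝕜)
    (hTp : ∀ p' p, Tp p' p = if p'.2 = 0 ∧ p.2 = 0 then T p'.1 p.1 else if p'.2 = 1 ∧ p.2 = 1 then J p'.1 p.1 else 0)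
    (Tm Jm : Γ₂ → Γ₁ → ℝ) (hT : ∀ x y, ‖T x y‖ ≤ Tm x y) (hJ : ∀ x y, ‖J x y‖ ≤ Jm x y)
    (p' : Γ₂ × Fin 2) (p : Γ₁ × Fin 2) :
    ‖Tp p' p‖ ≤ (if p'.2 = 0 ∧ p.2 = 0 then Tm p'.1 p.1 else if p'.2 = 1 ∧ p.2 = 1 then Jm p'.1 p.1 else 0) := by
  rw [hTp]
  split_ifs
  · exact hT _ _
  · exact hJ _ _
  · rw [norm_zero]

/-- **Entries of a difference of block substitutions** are the blockwise differences. [folklore] -/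
theorem doubleBlock_sub (T J T₂ J₂ : Matrix Γ₂ Γ₁ 𝕜) (Tp Tp₂ : Matrix (Γ₂ × Fin 2) (Γ₁ × Fin 2) 𝕜)
    (hTp : ∀ p' p, Tp p' p = if p'.2 = 0 ∧ p.2 = 0 then T p'.1 p.1 else if p'.2 = 1 ∧ p.2 = 1 then J p'.1 p.1 else 0)
    (hTp₂ : ∀ p' p, Tp₂ p' p = if p'.2 = 0 ∧ p.2 = 0 then T₂ p'.1 p.1 else if p'.2 = 1 ∧ p.2 = 1 then J₂ p'.1 p.1 else 0)
    (p' : Γ₂ × Fin 2) (p : Γ₁ × Fin 2) :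
    (Tp - Tp₂) p' p = if p'.2 = 0 ∧ p.2 = 0 then (T - T₂) p'.1 p.1 else if p'.2 = 1 ∧ p.2 = 1 then (J - J₂) p'.1 p.1 else 0 := by
  rw [Matrix.sub_apply, hTp, hTp₂]
  split_ifs <;> simp [Matrix.sub_apply]

end DoubleBlock

end Summit.HubbardSuperconductivity.HubbardSuperconductivity.Theorems.TwoVolumeDefect

end
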